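import Mathlib
import HarnessLib
import Literature.MathematicalPhysics.QuantumLattice.KohnLuttinger
import Literature.MathematicalPhysics.QuantumLattice.KohnLuttingerLindhardMeasurable
import Literature.Computability.MetaComplexity.TaylorCosineMinorants
import Summits.HubbardSuperconductivity.HubbardSuperconductivity.Theorems.ChiralWindowCwKLChiralWindowMuWindow
import Summits.HubbardSuperconductivity.HubbardSuperconductivity.Theorems.KLProgrammeMuOfDopingWindowConvex

/-!
# Route `WeakCouplingBCS` — support item `WcbcsKohnLuttingerB1g` (stmt-HubbardSuperconductivity-0158):
# certified fillings of the square-lattice band, I — tangent half-planes and circumscribed strips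

Infrastructure for two-sided certified bounds on the free filling
`n(μ) = 2 vol({ε₀ < μ} ∩ BZ) / (2π)²` of `ε₀ = squareDispersion 1 0` at hole dopings, i.e. on the
area of the convex Fermi sea `R_c = {(x, y) | |x + y| < π, |x - y| < π, c < cos x + cos y}`
(`c = -μ/2 > 0`; `convex_fermiSeaCoord`).  This file (no definitions, folklore):

* `klfill_log_cos_le_tangent` — the tangent-line inequality of the concave `log ∘ cos` on
  `(-π/2, π/2)`; `klfill_halfplane` — the SUPPORTING HALF-PLANE of the Fermi sea at a point `p` of
  the open diamond: if `cos p₁ + cos p₂ < cos q₁ + cos q₂` then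
  `sin p₁ (q₁ - p₁) + sin p₂ (q₂ - p₂) < 0` (via `cos x + cos y = 2 cos u cos v` and the tangent
  inequality for `log cos u + log cos v`);
* `klfill_strip_subset` — hence the part of `R_c` over an `x`-interval `(x₀, x₁]` lies in the
  symmetric trapezoid under a tangent line with certified rational data (CIRCUMSCRIBED polygons);
  `klfill_fst_lt` — the vertical cut `R_c ⊆ {x < X}` as soon as `cos X ≤ c - 1`;
  `klfill_subset_inter_pos` — bookkeeping for the half `x > 0` of an INSCRIBED polygon;
* fixed-order Taylor enclosures `klfill_cos_ge_taylor14`, `klfill_cos_le_taylor16`,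
  `klfill_sin_ge_taylor15`, `klfill_sin_le_taylor17` (from the tree's all-orders
  `cosTaylorSum_le_cos` / `cos_le_cosTaylorSum` / `sinTaylorSum_le_sin` / `sin_le_sinTaylorSum`).

Companions: `WeakCouplingBCSKlCertFillingCover.lean` (reflection symmetry, cover bookkeeping,
transport to the filling), `WeakCouplingBCSKlCertFillingLowerD010*.lean` (`n(-0.1775) ≥ 9/10`),
`WeakCouplingBCSKlCertFillingUpperD020*.lean` (`n(-0.42749) ≤ 4/5`), and the form-(A) δ-window statement
of the `B1g` certificate they serve (`WeakCouplingBCSWcbcsKohnLuttingerB1gFormAWindow.lean`).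
-/

noncomputable section

-- the tree's namespace `Summit.<Summit>.<Problem>.Theorems` repeats the summit name by design (D-0017)
set_option linter.dupNamespace false

namespace Summit.HubbardSuperconductivity.HubbardSuperconductivity.Theorems

open MeasureTheory Set Literature.MathematicalPhysics.QuantumLattice

/-! ### The tangent inequality of `log cos` and the supporting half-plane -/

/-- Tangent-line inequality of the concave function `log ∘ cos` on `(-π/2, π/2)`:
`log cos u ≤ log cos u₀ - tan u₀ · (u - u₀)`. [folklore] -/
theorem klfill_log_cos_le_tangent {u u₀ : ℝ} (hu : u ∈ Ioo (-(Real.pi / 2)) (Real.pi / 2))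
    (hu₀ : u₀ ∈ Ioo (-(Real.pi / 2)) (Real.pi / 2)) :
    Real.log (Real.cos u) ≤ Real.log (Real.cos u₀) - Real.tan u₀ * (u - u₀) := by
  have hd : HasDerivAt (fun u => Real.log (Real.cos u)) (-Real.tan u₀) u₀ := by
    have hc : Real.cos u₀ ≠ 0 := (Real.cos_pos_of_mem_Ioo hu₀).ne'
    have := (Real.hasDerivAt_cos u₀).log hc
    convert this using 1
    rw [Real.tan_eq_sin_div_cos]; ring
  rcases lt_trichotomy u₀ u with h | h | h
  · have hs := muWin_concaveOn_log_cos.slope_le_of_hasDerivAt hu₀ hu h hd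
    rw [slope_def_field] at hs
    have hpos : 0 < u - u₀ := sub_pos.2 h
    rw [div_le_iff₀ hpos] at hs
    linarith
  · subst h; simp
  · have hs := muWin_concaveOn_log_cos.le_slope_of_hasDerivAt hu hu₀ h hd
    rw [slope_def_field] at hs
    have hpos : 0 < u₀ - u := sub_pos.2 h
    rw [le_div_iff₀ hpos] at hs
    linarith

/-- **Supporting half-plane of the Fermi sea.** For `p, q` in the open diamond
`{|x + y| < π, |x - y| < π}` with `cos p₁ + cos p₂ < cos q₁ + cos q₂`:
`sin p₁ (q₁ - p₁) + sin p₂ (q₂ - p₂) < 0`, i.e. every strictly higher superlevel set of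
`cos x + cos y` lies in the open half-plane through `p` with inner normal `-(sin p₁, sin p₂)`
(tangent inequality for the concave `log cos ((x+y)/2) + log cos ((x-y)/2)`). [folklore] -/
theorem klfill_halfplane {p q : ℝ × ℝ} (hp : |p.1 + p.2| < Real.pi ∧ |p.1 - p.2| < Real.pi)
    (hq : |q.1 + q.2| < Real.pi ∧ |q.1 - q.2| < Real.pi)
    (hlt : Real.cos p.1 + Real.cos p.2 < Real.cos q.1 + Real.cos q.2) :
    Real.sin p.1 * (q.1 - p.1) + Real.sin p.2 * (q.2 - p.2) < 0 := by
  have hp1 := abs_lt.1 hp.1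
  have hp2 := abs_lt.1 hp.2
  have hq1 := abs_lt.1 hq.1
  have hq2 := abs_lt.1 hq.2
  have hu : (q.1 + q.2) / 2 ∈ Ioo (-(Real.pi / 2)) (Real.pi / 2) := ⟨by linarith, by linarith⟩
  have hv : (q.1 - q.2) / 2 ∈ Ioo (-(Real.pi / 2)) (Real.pi / 2) := ⟨by linarith, by linarith⟩
  have hu₀ : (p.1 + p.2) / 2 ∈ Ioo (-(Real.pi / 2)) (Real.pi / 2) := ⟨by linarith, by linarith⟩
  have hv₀ : (p.1 - p.2) / 2 ∈ Ioo (-(Real.pi / 2)) (Real.pi / 2) := ⟨by linarith, by linarith⟩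
  have cu : 0 < Real.cos ((q.1 + q.2) / 2) := Real.cos_pos_of_mem_Ioo hu
  have cv : 0 < Real.cos ((q.1 - q.2) / 2) := Real.cos_pos_of_mem_Ioo hv
  have cu₀ : 0 < Real.cos ((p.1 + p.2) / 2) := Real.cos_pos_of_mem_Ioo hu₀
  have cv₀ : 0 < Real.cos ((p.1 - p.2) / 2) := Real.cos_pos_of_mem_Ioo hv₀
  have hprq := Real.cos_add_cos q.1 q.2
  have hprp := Real.cos_add_cos p.1 p.2
  have hlt' : Real.cos ((p.1 + p.2) / 2) * Real.cos ((p.1 - p.2) / 2) <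
      Real.cos ((q.1 + q.2) / 2) * Real.cos ((q.1 - q.2) / 2) := by nlinarith
  have hlog : Real.log (Real.cos ((p.1 + p.2) / 2)) + Real.log (Real.cos ((p.1 - p.2) / 2)) <
      Real.log (Real.cos ((q.1 + q.2) / 2)) + Real.log (Real.cos ((q.1 - q.2) / 2)) := by
    rw [← Real.log_mul cu₀.ne' cv₀.ne', ← Real.log_mul cu.ne' cv.ne']
    exact Real.log_lt_log (mul_pos cu₀ cv₀) hlt'
  have t1 := klfill_log_cos_le_tangent hu hu₀
  have t2 := klfill_log_cos_le_tangent hv hv₀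
  have key : Real.tan ((p.1 + p.2) / 2) * ((q.1 + q.2) / 2 - (p.1 + p.2) / 2) +
      Real.tan ((p.1 - p.2) / 2) * ((q.1 - q.2) / 2 - (p.1 - p.2) / 2) < 0 := by linarith
  rw [Real.tan_eq_sin_div_cos, Real.tan_eq_sin_div_cos] at key
  have key2 : Real.sin ((p.1 + p.2) / 2) * Real.cos ((p.1 - p.2) / 2) *
        ((q.1 + q.2) / 2 - (p.1 + p.2) / 2) +
      Real.cos ((p.1 + p.2) / 2) * Real.sin ((p.1 - p.2) / 2) *
        ((q.1 - q.2) / 2 - (p.1 - p.2) / 2) < 0 := by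
    have hm := mul_neg_of_pos_of_neg (mul_pos cu₀ cv₀) key
    have e : Real.cos ((p.1 + p.2) / 2) * Real.cos ((p.1 - p.2) / 2) *
        (Real.sin ((p.1 + p.2) / 2) / Real.cos ((p.1 + p.2) / 2) * ((q.1 + q.2) / 2 - (p.1 + p.2) / 2) +
          Real.sin ((p.1 - p.2) / 2) / Real.cos ((p.1 - p.2) / 2) *
            ((q.1 - q.2) / 2 - (p.1 - p.2) / 2)) =
        Real.sin ((p.1 + p.2) / 2) * Real.cos ((p.1 - p.2) / 2) * ((q.1 + q.2) / 2 - (p.1 + p.2) / 2) +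
          Real.cos ((p.1 + p.2) / 2) * Real.sin ((p.1 - p.2) / 2) *
            ((q.1 - q.2) / 2 - (p.1 - p.2) / 2) := by
      field_simp
    rw [e] at hm
    exact hm
  have e1 : Real.sin p.1 = Real.sin ((p.1 + p.2) / 2) * Real.cos ((p.1 - p.2) / 2) +
      Real.cos ((p.1 + p.2) / 2) * Real.sin ((p.1 - p.2) / 2) := by
    rw [← Real.sin_add]; congr 1; ring
  have e2 : Real.sin p.2 = Real.sin ((p.1 + p.2) / 2) * Real.cos ((p.1 - p.2) / 2) -
      Real.cos ((p.1 + p.2) / 2) * Real.sin ((p.1 - p.2) / 2) := by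
    rw [← Real.sin_sub]; congr 1; ring
  rw [e1, e2]
  nlinarith [key2]

/-! ### Circumscribed strips -/

/-- **A strip of the Fermi sea under a certified tangent line.** Let `(a, b)` lie in the open
diamond with `sin b > 0` and `cos a + cos b ≤ c` (a point on or outside the level curve), and let
`r` be a rational bound of the slope ratio `sin a / sin b` on the correct side: `r sin b ≤ sin a` if
the strip `(x₀, x₁]` lies to the right of `a` (`a ≤ x₀`), `sin a ≤ r sin b` if it lies to the left
(`x₁ ≤ a`).  Then the part of `R_c` over `(x₀, x₁]` lies in the symmetric trapezoid
`{x ∈ (x₀, x₁], |y| < b - r (x - a)}`, written with its node values `y₀, y₁`. [folklore] -/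
theorem klfill_strip_subset {c x₀ x₁ a b r y₀ y₁ : ℝ} (hx : x₀ < x₁)
    (hab : |a + b| < Real.pi ∧ |a - b| < Real.pi) (hb : 0 < Real.sin b)
    (hcab : Real.cos a + Real.cos b ≤ c)
    (side : (a ≤ x₀ ∧ r * Real.sin b ≤ Real.sin a) ∨ (x₁ ≤ a ∧ Real.sin a ≤ r * Real.sin b))
    (hy₀ : y₀ = b - r * (x₀ - a)) (hy₁ : y₁ = b - r * (x₁ - a)) :
    {q : ℝ × ℝ | |q.1 + q.2| < Real.pi ∧ |q.1 - q.2| < Real.pi ∧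
        c < Real.cos q.1 + Real.cos q.2} ∩ (Ioc x₀ x₁ ×ˢ (univ : Set ℝ)) ⊆
      regionBetween (fun x => -(y₀ + (y₁ - y₀) / (x₁ - x₀) * (x - x₀)))
        (fun x => y₀ + (y₁ - y₀) / (x₁ - x₀) * (x - x₀)) (Ioc x₀ x₁) := by
  rintro ⟨x, y⟩ ⟨⟨h1, h2, h3⟩, ⟨hxI, -⟩⟩
  have hxne : x₁ - x₀ ≠ 0 := sub_ne_zero.2 hx.ne'
  have hline : y₀ + (y₁ - y₀) / (x₁ - x₀) * (x - x₀) = b - r * (x - a) := by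
    rw [hy₀, hy₁]; field_simp; ring
  simp only [regionBetween, mem_setOf_eq, mem_Ioo]
  refine ⟨hxI, ?_⟩
  rw [hline]
  -- the half-plane at `(a, b)` applied to `(x, y)` and to `(x, -y)`
  have key : ∀ y' : ℝ, (|x + y'| < Real.pi ∧ |x - y'| < Real.pi ∧
      c < Real.cos x + Real.cos y') → y' < b - r * (x - a) := by
    intro y' hy'
    have hh := klfill_halfplane (p := (a, b)) (q := (x, y')) hab ⟨hy'.1, hy'.2.1⟩
      (by simpa using lt_of_le_of_lt hcab hy'.2.2)
    simp only at hh
    -- `sin a (x - a) + sin b (y' - b) < 0`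
    rcases side with ⟨hax, hr⟩ | ⟨hxa, hr⟩
    · have hxa : 0 ≤ x - a := by linarith [hxI.1]
      have h2 : Real.sin b * (y' - b) < Real.sin b * (-(r * (x - a))) := by
        nlinarith [mul_le_mul_of_nonneg_right hr hxa]
      have h3 := lt_of_mul_lt_mul_left h2 hb.le
      linarith
    · have hxa' : 0 ≤ a - x := by linarith [hxI.2]
      have h2 : Real.sin b * (y' - b) < Real.sin b * (-(r * (x - a))) := by
        nlinarith [mul_le_mul_of_nonneg_right hr hxa']
      have h3 := lt_of_mul_lt_mul_left h2 hb.le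
      linarith
  constructor
  · have := key (-y) (by
      refine ⟨?_, ?_, by simpa only [Real.cos_neg] using h3⟩
      · rw [show x + -y = x - y by ring]; exact h2
      · rw [show x - -y = x + y by ring]; exact h1)
    linarith
  · exact key y ⟨h1, h2, h3⟩

/-- **Vertical cut.** If `0 ≤ X` and `cos X ≤ c - 1` then every point of `R_c` has `x < X`
(`cos x > c - cos y ≥ c - 1 ≥ cos X` and `cos` is decreasing on `[0, π]`). [folklore] -/
theorem klfill_fst_lt {c X : ℝ} (hX0 : 0 ≤ X) (hcos : Real.cos X ≤ c - 1)
    {q : ℝ × ℝ} (hq : q ∈ {q : ℝ × ℝ | |q.1 + q.2| < Real.pi ∧ |q.1 - q.2| < Real.pi ∧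
      c < Real.cos q.1 + Real.cos q.2}) : q.1 < X := by
  obtain ⟨h1, h2, h3⟩ := hq
  have ha := abs_lt.1 h1
  have hb := abs_lt.1 h2
  by_contra hle
  push Not at hle
  have hxπ : q.1 ≤ Real.pi := by linarith
  have hcos' : Real.cos q.1 ≤ Real.cos X := Real.cos_le_cos_of_nonneg_of_le_pi hX0 hxπ hle
  linarith [Real.cos_le_one q.2]

/-- A trapezoid over `(s, t]` with `s ≥ 0` that lies in `R` lies in `R ∩ {0 < x}` (bookkeeping for the
half `x > 0` of an inscribed polygon). [folklore] -/
theorem klfill_subset_inter_pos {R : Set (ℝ × ℝ)} {f g : ℝ → ℝ} {s t : ℝ} (hs : 0 ≤ s)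
    (hPR : regionBetween f g (Ioc s t) ⊆ R) :
    regionBetween f g (Ioc s t) ⊆ R ∩ {q : ℝ × ℝ | 0 < q.1} :=
  fun _ hq => ⟨hPR hq, lt_of_le_of_lt hs ((regionBetween_subset f g _ hq).1).1⟩

/-! ### Fixed-order Taylor enclosures of `cos` and `sin` -/

/-- Degree-`14` Taylor minorant of `cos` on `ℝ` (`cosTaylorSum_le_cos`, `M = 7`). [folklore] -/
theorem klfill_cos_ge_taylor14 (y : ℝ) :
    1 - y ^ 2 / 2 + y ^ 4 / 24 - y ^ 6 / 720 + y ^ 8 / 40320 - y ^ 10 / 3628800 +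
      y ^ 12 / 479001600 - y ^ 14 / 87178291200 ≤ Real.cos y := by
  have h := Literature.Computability.MetaComplexity.cosTaylorSum_le_cos (M := 7) (by decide) y
  simp only [Finset.sum_range_succ, Finset.sum_range_zero] at h
  norm_num [Nat.factorial] at h
  linarith

/-- Degree-`16` Taylor majorant of `cos` on `ℝ` (`cos_le_cosTaylorSum`, `M = 8`). [folklore] -/
theorem klfill_cos_le_taylor16 (y : ℝ) :
    Real.cos y ≤ 1 - y ^ 2 / 2 + y ^ 4 / 24 - y ^ 6 / 720 + y ^ 8 / 40320 - y ^ 10 / 3628800 +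
      y ^ 12 / 479001600 - y ^ 14 / 87178291200 + y ^ 16 / 20922789888000 := by
  have h := Literature.Computability.MetaComplexity.cos_le_cosTaylorSum (M := 8) (by decide) y
  simp only [Finset.sum_range_succ, Finset.sum_range_zero] at h
  norm_num [Nat.factorial] at h
  linarith

/-- Degree-`15` Taylor minorant of `sin` on `[0, ∞)` (`sinTaylorSum_le_sin`, `M = 7`). [folklore] -/
theorem klfill_sin_ge_taylor15 {y : ℝ} (hy : 0 ≤ y) :
    y - y ^ 3 / 6 + y ^ 5 / 120 - y ^ 7 / 5040 + y ^ 9 / 362880 - y ^ 11 / 39916800 +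
      y ^ 13 / 6227020800 - y ^ 15 / 1307674368000 ≤ Real.sin y := by
  have h := Literature.Computability.MetaComplexity.sinTaylorSum_le_sin (M := 7) (by decide) hy
  simp only [Finset.sum_range_succ, Finset.sum_range_zero] at h
  norm_num [Nat.factorial] at h
  linarith

/-- Degree-`17` Taylor majorant of `sin` on `[0, ∞)` (`sin_le_sinTaylorSum`, `M = 8`). [folklore] -/
theorem klfill_sin_le_taylor17 {y : ℝ} (hy : 0 ≤ y) :
    Real.sin y ≤ y - y ^ 3 / 6 + y ^ 5 / 120 - y ^ 7 / 5040 + y ^ 9 / 362880 - y ^ 11 / 39916800 +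
      y ^ 13 / 6227020800 - y ^ 15 / 1307674368000 + y ^ 17 / 355687428096000 := by
  have h := Literature.Computability.MetaComplexity.sin_le_sinTaylorSum (M := 8) (by decide) hy
  simp only [Finset.sum_range_succ, Finset.sum_range_zero] at h
  norm_num [Nat.factorial] at h
  linarith

end Summit.HubbardSuperconductivity.HubbardSuperconductivity.Theorems

end
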